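import Summits.QuantumFields.YangMills.Theorems.BalabanUVNodesN07DbarHQnearGuards
import Summits.QuantumFields.YangMills.Theorems.BalabanUVNodesK0S5HBRows164CoreCubeSeq
import Literature.MathematicalPhysics.QuantumFieldTheory.Balaban1983to89.Node00.TorusCoverGaugeTokensRPrint
import HarnessLib

/-!
# N07 [B11] (= [15] = [Balaban1985Variational]) Sect. F — MODULE 118: **THE K0 ASSEMBLER's NUMERICS OF THE HEAD TOKEN 100⁵ ARE JOINTLY SATISFIABLE — GUARDS AND THE ONE
# CLOSED-FORM BUDGET ROW — UNDER THE ONE COLLAR-THRESHOLD LETTER `32·sideP·C_H·B_H·e^{−δ_H ρ}·κ·L ≤ 1`, AND THAT LETTER HOLDS FOR EVERY LARGE COLLAR**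

Cell `pub-ymgap`, seat `pub-ymgap-dag-n07-e` g31 (FAN-OUT §N07 row s3; LANE OWNER of the K0 road chart side).  `--kind proof --supports stmt-QuantumFields-20541 --as helper` (K0⁷);
count-neutral; TWO theorems (0 `def`); elementary real arithmetic.  [15] = [Balaban1985Variational]; [6] = [Balaban1985RegularSpaces]; [3] = [Balaban1985Averaging].

WHY.  The head token of record 100⁵ `…N07Prop8StepTokenOfRecordSym152CprimeDprime.prop8RegSepTopStepG_of_hThm4RecSym152PhiE_cprime_dprime` ✓p748785 concludes
`Prop8RegSepTopStepG F N suppDom Adm B₃ a₀ a₁` from structural letters, the numeric GUARDS on `B₃ C θ Q κ a₀ a₁ Ψ` (twelve scalar rows, the five `a₀`-rows and two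
`a₁`-rows of 99″, the per-level defect rows), ONE closed-form BUDGET ROW `C₁(κε_j)² + ¼·sideP·max(4C_H B_H·β₁ ε δ j, 8C_H B_H e^{−δ_H ρ}·κ·L·ε_j) < C·δ_j + θ·ε_j + Q·ε_j²`
(ranged over `0 < δ_j ≤ a₁`, `B₃δ_j ≤ ε_j ≤ a₀`), the conditional premise `hT : HThm4RecSym152PhiE …` and HSEAM.  MODULE 99″-guards (`exists_guards_symPhiE` ✓p748621) showed the
guards alone satisfiable.  THIS FILE shows that ALL the numerics — guards AND budget row, with `κ·a₀ ≤ τ` and any prescribed ceiling `a₀ ≤ a_max` (so that a premise supplied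
at a larger `a₀` transports by `hThm4RecSym152PhiE_mono`) — are met by ONE choice of `B₃ C θ Q a₀ a₁` at `Ψ ε j := ψc·(κ·ε_j)²`, PROVIDED the collar `ρ` satisfies the
ONE letter `32·sideP(Mc, ρ)·C_H·B_H·e^{−δ_H ρ}·κ·L ≤ 1` — which is the necessary condition (Θ) of ⚑ LOCATED-COLLAR-THRESHOLD (n07-e g27; desk memo): the far branch of the
`max` is LINEAR in `ε_j` with coefficient `2·sideP·C_H·B_H·e^{−δ_H ρ}·κ·L`, and `16θ ≤ 1`.  §2 shows the letter holds for EVERY `ρ` above a threshold when `κ` is the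
junction's affine-in-`ρ` constant `b9OfP F Mc ρ B₁` ([15] p. 304 (163): «We may assume that R₁M₁ is sufficiently big»; p. 300 «R … sufficiently large» — print chooses
the collar AFTER `B₁`), by k0-s1's constant-weight `K0S5HBRows164CoreCubeSeq.exists_collar_threshold` BY NAME after `(ρ+1)² ≤ (8∕δ²)·e^{δ(ρ+1)∕2}`.

WHAT IS PROVED (sorry-free; axioms standard).
§1 ★★ `exists_numerics_budget_symPhiE` — witnesses: `θ := 2·S·C_H·B_H·E·κ·L` (`S := sideP`, `E := e^{−δ_H ρ}`; the far branch IS `θ·ε_j`), `C := 2·S·C_H·B_H·L·X₀′ + 1`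
   (`X₀′` = 99″'s δ-coefficient; the `+1` makes the row strict), `Q := κ²·(C₁ + S·C_H·B_H·L·(12·c_ω + 64·60800·ℓ²·L²))` with `c_ω := c_φ + 6ψc + 6c_φψc`, `c_φ := 100·(240ℓ²L)²`
   (`ω_j ≤ c_ω·(κε_j)²`, `Ω_j = 2ω_j + ω_j² ≤ 3ω_j`), `B₃ := 2L² + 4C`, `a₀ := m₀∕(G + 1)` (`G` collects every `a₀`-coefficient, `m₀ = min 10⁻³ (min δ_N δ_F∕2)`), `a₁ := m₁∕(X₀′ + T₁ + T_F + 1)`.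
§2 ★ `collar_letter_eventually` — `∃ ρth, ∀ ρ ≥ ρth, 32·sideP(Mc,ρ)·C_H·B_H·e^{−δ_H ρ}·(b9OfP F Mc ρ B₁·L) ≤ 1` (`C_H, B_H, B₁ ≥ 0`, `δ_H > 0`).
HONEST SCOPE: the K0 assembler's numerics ONLY — the conditional premise `HThm4RecSym152PhiE` (N05's (B′) road) and HSEAM ((ii)-docket) are NOT touched; nothing of
[15]∕[6]∕[3] asserted; NO stub registered or closed; K0⁷ ∕ K1⁹ NOT closed; N07 NOT discharged and NOT claimable; counts unmoved (typed 28∕28 · discharged 8∕28); one finite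
𝕋⁴ programme at fixed ε — the route closes the conditional finite-𝕋⁴ rung `BalabanLadder.UV` ONLY; the YM mass gap (Clay) is NOT proved by any of this; nothing continuum ∕
ℝ⁴ ∕ OS.  No `def`, no `instance`, no `notation`, no `sorry`.

References: [15] (144) p. 300, (152) p. 301, (160)–(163) pp. 303–304; [6] Prop. 6 p. 99, p. 98 («M is a multiple of R₁M₁»); [3] (26) p. 22, (78)–(81) p. 30.
-/

set_option autoImplicit false

noncomputable section

namespace Summit.QuantumFields.YangMills.BalabanUVNodes.N07SymBudgetRowClosure

open Literature.MathematicalPhysics.QuantumFieldTheory.Balaban1983to89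
open Literature.MathematicalPhysics.QuantumFieldTheory.Balaban1983to89.Node00
open T4Continuum (T4Family)
open ExpMeanLog (deltaSU deltaSU_pos)
open FederbushMean (federbushSU deltaFed deltaFed_pos federbushSU_δ)
open B8Eq131Cubes (crad)
open Summit.QuantumFields.YangMills.Theorems.K0S5HBRows164CoreCubeSeq (exists_collar_threshold)

variable (F : T4Family) (N : ℕ) [NeZero N]

/-! ## §1  Guards AND budget row, jointly, under the collar letter -/

set_option maxHeartbeats 1600000 in
/-- ★★ **THE NUMERICS OF THE HEAD 100⁵ ARE JOINTLY SATISFIABLE UNDER THE COLLAR LETTER**: for `κ > 0`, `ψc, C_H, C₁ ≥ 0`, `B_H, τ, a_max > 0` and a collar with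
`32·sideP·C_H·B_H·e^{−δ_H ρ}·κ·L ≤ 1`, there are `B₃ C θ Q a₀ a₁` meeting every numeric guard of 100⁵, `κ·a₀ ≤ τ`, `a₀ ≤ a_max`, the per-level defect guards at
`Ψ ε j := ψc·(κ·ε_j)²`, AND the ONE closed-form budget row (statement = 100⁵'s hypothesis list at that `Ψ`, character for character).
[cite: Balaban1985Variational, (152) p.301, (160)–(163) pp.303–304; Balaban1985Averaging, (26) p.22, (78)–(81) p.30] -/
theorem exists_numerics_budget_symPhiE (Mc ρ : ℕ) {κ ψc CH BH δH C₁ τ amax : ℝ} (hκ : 0 < κ) (hψc : 0 ≤ ψc) (hCH : 0 ≤ CH) (hBH : 0 < BH)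
    (hC₁ : 0 ≤ C₁) (hτ : 0 < τ) (hamax : 0 < amax)
    (hcollar : 32 * ((sideP (F.P 0) Mc ρ : ℕ) : ℝ) * CH * BH * Real.exp (-(δH * (ρ : ℝ))) * (κ * (F.L : ℝ)) ≤ 1) :
    ∃ B₃ C θ Q a₀ a₁ : ℝ,
      0 < B₃ ∧
      0 ≤ C ∧
      0 ≤ θ ∧
      0 ≤ Q ∧
      0 < a₀ ∧
      a₀ ≤ amax ∧
      0 < a₁ ∧
      2 * (F.L : ℝ) ^ 2 ≤ B₃ ∧
      4 * C ≤ B₃ ∧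
      16 * θ ≤ 1 ∧
      (16 * Q + 1024 * κ ^ 2) * a₀ ≤ 1 ∧
      32 * κ * a₀ ≤ 1 ∧
      κ * a₀ ≤ τ ∧
      243200 * (((4 + 2) * F.L : ℕ) : ℝ) ^ 2 * (κ * a₀ * (F.L : ℝ)) ≤ 1 ∧
      60 * (((4 + 2) * F.L : ℕ) : ℝ) ^ 2 * (κ * a₀ * (F.L : ℝ)) < deltaSU (Fin N) ∧
      5760 * (((4 + 2) * F.L : ℕ) : ℝ) ^ 2 * (κ * a₀ * (F.L : ℝ)) < deltaFed (Fin N) ∧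
      2880 * (((4 + 2) * F.L : ℕ) : ℝ) ^ 2 * (κ * a₀ * (F.L : ℝ)) < deltaSU (Fin N) ∧
      240 * (((4 + 2) * F.L : ℕ) : ℝ) ^ 2 * (κ * a₀ * (F.L : ℝ)) ≤ 1 / 10000 ∧
      ((((4 + 2) * F.L : ℕ) : ℝ) ^ 2 / 4) * ((4 * (((4 - 1 : ℕ) : ℝ) * ((2 * F.L - 1 : ℕ) : ℝ)) + 1) * a₁) < deltaSU (Fin N) ∧
      2 * (((4 * ((F.L - 1) / 2) : ℕ) : ℝ) * ((((4 - 1 : ℕ) : ℝ) * ((F.L - 1 : ℕ) : ℝ)) * a₁)) < (federbushSU (n := Fin N)).δ ∧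
      (∀ (ε : ℕ → ℝ) (j : ℕ), 0 ≤ ε j → ε j ≤ a₀ → 0 ≤ (ψc * (κ * ε j) ^ 2) ∧ (ψc * (κ * ε j) ^ 2) ≤ 1 / 32 ∧
          (((4 - 1 : ℕ) : ℝ) * ((crad (ρ * ((Mc + 11 * 4) / ρ + 2)) ρ : ℕ) : ℝ) * (1 + 2 * (((F.L : ℝ) ^ 2 + 6 * (((4 + 2) * F.L : ℕ) : ℝ) ^ 2) * (4 * (((4 - 1 : ℕ) : ℝ) * ((2 * F.L - 1 : ℕ) : ℝ)) + 1))) + 14 * ((((4 + 2) * F.L : ℕ) : ℝ) ^ 2 / 4 * (4 * (((4 - 1 : ℕ) : ℝ) * ((2 * F.L - 1 : ℕ) : ℝ)) + 1)) + 2 * (((4 + 1) * (F.L - 1) : ℕ) : ℝ) * ((((14 * (4 * ((F.L - 1) / 2)) + 1 : ℕ) : ℝ)) * (((4 - 1 : ℕ) : ℝ) * ((F.L - 1 : ℕ) : ℝ)))) * a₁ +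
          2 * ((100 * (240 * (((4 + 2) * F.L : ℕ) : ℝ) ^ 2 * (κ * ε j * (F.L : ℝ))) ^ 2 + 6 * (ψc * (κ * ε j) ^ 2) + 100 * (240 * (((4 + 2) * F.L : ℕ) : ℝ) ^ 2 * (κ * ε j * (F.L : ℝ))) ^ 2 * (6 * (ψc * (κ * ε j) ^ 2))) + (100 * (240 * (((4 + 2) * F.L : ℕ) : ℝ) ^ 2 * (κ * ε j * (F.L : ℝ))) ^ 2 + 6 * (ψc * (κ * ε j) ^ 2) + 100 * (240 * (((4 + 2) * F.L : ℕ) : ℝ) ^ 2 * (κ * ε j * (F.L : ℝ))) ^ 2 * (6 * (ψc * (κ * ε j) ^ 2))) + (100 * (240 * (((4 + 2) * F.L : ℕ) : ℝ) ^ 2 * (κ * ε j * (F.L : ℝ))) ^ 2 + 6 * (ψc * (κ * ε j) ^ 2) + 100 * (240 * (((4 + 2) * F.L : ℕ) : ℝ) ^ 2 * (κ * ε j * (F.L : ℝ))) ^ 2 * (6 * (ψc * (κ * ε j) ^ 2))) * (100 * (240 * (((4 + 2) * F.L : ℕ) : ℝ) ^ 2 * (κ * ε j * (F.L : ℝ)))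 ^ 2 + 6 * (ψc * (κ * ε j) ^ 2) + 100 * (240 * (((4 + 2) * F.L : ℕ) : ℝ) ^ 2 * (κ * ε j * (F.L : ℝ))) ^ 2 * (6 * (ψc * (κ * ε j) ^ 2)))) ≤ 1 / 2) ∧
      (∀ (K : ℕ) (ε δ : ℕ → ℝ) (j : ℕ), 0 < δ j → δ j ≤ a₁ → B₃ * δ j ≤ ε j → ε j ≤ a₀ →
          C₁ * (κ * ε j) ^ 2 + 1 / 4 * ((sideP (F.P K) Mc ρ : ℕ) : ℝ) *
          max (4 * CH * BH * ((fun (ε δ : ℕ → ℝ) (j : ℕ) => (F.L : ℝ) * (2 * ((((4 - 1 : ℕ) : ℝ) * ((crad (ρ * ((Mc + 11 * 4) / ρ + 2)) ρ : ℕ) : ℝ) * (1 + 2 * (((F.L : ℝ) ^ 2 + 6 * (((4 + 2) * F.L : ℕ) : ℝ) ^ 2) * (4 * (((4 - 1 : ℕ) : ℝ) * ((2 * F.L - 1 : ℕ) : ℝ)) + 1))) + 14 * ((((4 + 2) * F.L : ℕ) : ℝ) ^ 2 / 4 * (4 * (((4 - 1 : ℕ) : ℝ) * ((2 * F.L - 1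 : ℕ) : ℝ)) + 1)) + 2 * (((4 + 1) * (F.L - 1) : ℕ) : ℝ) * ((((14 * (4 * ((F.L - 1) / 2)) + 1 : ℕ) : ℝ)) * (((4 - 1 : ℕ) : ℝ) * ((F.L - 1 : ℕ) : ℝ)))) * δ j + ((100 * (240 * (((4 + 2) * F.L : ℕ) : ℝ) ^ 2 * (κ * ε j * (F.L : ℝ))) ^ 2 + 6 * (ψc * (κ * ε j) ^ 2) + 100 * (240 * (((4 + 2) * F.L : ℕ) : ℝ) ^ 2 * (κ * ε j * (F.L : ℝ))) ^ 2 * (6 * (ψc * (κ * ε j) ^ 2))) + (100 * (240 * (((4 + 2) * F.L : ℕ) : ℝ) ^ 2 * (κ * ε j * (F.L : ℝ))) ^ 2 + 6 * (ψc * (κ * ε j) ^ 2) + 100 * (240 * (((4 + 2) * F.L : ℕ) : ℝ) ^ 2 * (κ * ε j * (F.L : ℝ))) ^ 2 * (6 * (ψc * (κ * ε j) ^ 2))) + (100 * (240 * (((4 + 2) * F.L : ℕ) : ℝ) ^ 2 * (κ * ε j * (F.L : ℝ))) ^ 2 + 6 * (ψc * (κ * ε j) ^ 2) + 100 * (240 *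 (((4 + 2) * F.L : ℕ) : ℝ) ^ 2 * (κ * ε j * (F.L : ℝ))) ^ 2 * (6 * (ψc * (κ * ε j) ^ 2))) * (100 * (240 * (((4 + 2) * F.L : ℕ) : ℝ) ^ 2 * (κ * ε j * (F.L : ℝ))) ^ 2 + 6 * (ψc * (κ * ε j) ^ 2) + 100 * (240 * (((4 + 2) * F.L : ℕ) : ℝ) ^ 2 * (κ * ε j * (F.L : ℝ))) ^ 2 * (6 * (ψc * (κ * ε j) ^ 2)))) * (1 + (((4 - 1 : ℕ) : ℝ) * ((crad (ρ * ((Mc + 11 * 4) / ρ + 2)) ρ : ℕ) : ℝ) * (1 + 2 * (((F.L : ℝ) ^ 2 + 6 * (((4 + 2) * F.L : ℕ) : ℝ) ^ 2) * (4 * (((4 - 1 : ℕ) : ℝ) * ((2 * F.L - 1 : ℕ) : ℝ)) + 1))) + 14 * ((((4 + 2) * F.L : ℕ) : ℝ) ^ 2 / 4 * (4 * (((4 - 1 : ℕ) : ℝ) * ((2 * F.L - 1 : ℕ) : ℝ)) + 1)) + 2 * (((4 + 1) * (F.L - 1) : ℕ) : ℝ) * ((((14 * (4 * ((F.L - 1)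 / 2)) + 1 : ℕ) : ℝ)) * (((4 - 1 : ℕ) : ℝ) * ((F.L - 1 : ℕ) : ℝ)))) * δ j)) + 64 * 60800 * (((4 + 2) * F.L : ℕ) : ℝ) ^ 2 * (κ * ε j * (F.L : ℝ)) ^ 2)) ε δ j)) (8 * CH * BH * Real.exp (-(δH * (ρ : ℝ))) * (κ * (F.L : ℝ) * ε j)) <
          C * δ j + θ * ε j + Q * ε j ^ 2) := by
  have hδN : 0 < deltaSU (Fin N) := deltaSU_pos
  have hδF : 0 < deltaFed (Fin N) := deltaFed_pos
  have hL0 : (0 : ℝ) ≤ F.L := Nat.cast_nonneg _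
  have hκ0 : 0 ≤ κ := hκ.le
  -- opaque atoms (99″-guards style)
  obtain ⟨kc, hkc⟩ : ∃ kc : ℝ, kc = (((14 * (4 * ((F.L - 1) / 2)) + 1 : ℕ) : ℝ)) := ⟨_, rfl⟩
  obtain ⟨kF, hkF⟩ : ∃ kF : ℝ, kF = (((4 * ((F.L - 1) / 2) : ℕ) : ℝ)) := ⟨_, rfl⟩
  rw [← hkc, ← hkF]
  have hkc0 : 0 ≤ kc := by rw [hkc]; exact Nat.cast_nonneg _
  have hkF0 : 0 ≤ kF := by rw [hkF]; exact Nat.cast_nonneg _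
  obtain ⟨ℓ2, hℓ2⟩ : ∃ ℓ2 : ℝ, ℓ2 = (((4 + 2) * F.L : ℕ) : ℝ) ^ 2 := ⟨_, rfl⟩
  rw [← hℓ2]
  have hℓ20 : 0 ≤ ℓ2 := by rw [hℓ2]; positivity
  obtain ⟨X0, hX0⟩ : ∃ X0 : ℝ, X0 = ((((4 - 1 : ℕ) : ℝ) * ((crad (ρ * ((Mc + 11 * 4) / ρ + 2)) ρ : ℕ) : ℝ) * (1 + 2 * (((F.L : ℝ) ^ 2 + 6 * ℓ2) * (4 * (((4 - 1 : ℕ) : ℝ) * ((2 * F.L - 1 : ℕ) : ℝ)) + 1))) + 14 * (ℓ2 / 4 * (4 * (((4 - 1 : ℕ) : ℝ) * ((2 * F.L - 1 : ℕ) : ℝ)) + 1)) + 2 * (((4 + 1) * (F.L - 1) : ℕ) : ℝ) * (kc * ((((4 - 1 : ℕ) : ℝ) * ((F.L - 1 : ℕ) : ℝ)))))) := ⟨_, rfl⟩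
  rw [← hX0]
  have hX00 : 0 ≤ X0 := by rw [hX0]; positivity
  obtain ⟨T₁, hT₁⟩ : ∃ T₁ : ℝ, T₁ = (ℓ2 / 4) * (4 * (((4 - 1 : ℕ) : ℝ) * ((2 * F.L - 1 : ℕ) : ℝ)) + 1) := ⟨_, rfl⟩
  have hT₁0 : 0 ≤ T₁ := by rw [hT₁]; positivity
  obtain ⟨TF, hTF⟩ : ∃ TF : ℝ, TF = 2 * (kF * (((4 - 1 : ℕ) : ℝ) * ((F.L - 1 : ℕ) : ℝ))) := ⟨_, rfl⟩
  have hTF0 : 0 ≤ TF := by rw [hTF]; positivity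
  obtain ⟨E, hE⟩ : ∃ E : ℝ, E = Real.exp (-(δH * (ρ : ℝ))) := ⟨_, rfl⟩
  rw [← hE] at hcollar ⊢
  have hE0 : 0 < E := by rw [hE]; exact Real.exp_pos _
  obtain ⟨S, hS⟩ : ∃ S : ℝ, S = ((sideP (F.P 0) Mc ρ : ℕ) : ℝ) := ⟨_, rfl⟩
  rw [← hS] at hcollar
  have hS0 : 0 ≤ S := by rw [hS]; exact Nat.cast_nonneg _
  have hSK : ∀ K : ℕ, ((sideP (F.P K) Mc ρ : ℕ) : ℝ) = S := fun K => by rw [hS]; rfl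
  -- the head's constants
  obtain ⟨Hd, hHd⟩ : ∃ Hd : ℝ, Hd = S * CH * BH * (F.L : ℝ) := ⟨_, rfl⟩
  have hHd0 : 0 ≤ Hd := by rw [hHd]; positivity
  obtain ⟨cφ, hcφ⟩ : ∃ cφ : ℝ, cφ = 100 * (240 * ℓ2 * (F.L : ℝ)) ^ 2 := ⟨_, rfl⟩
  have hcφ0 : 0 ≤ cφ := by rw [hcφ]; positivity
  obtain ⟨cω, hcω⟩ : ∃ cω : ℝ, cω = cφ + 6 * ψc + 6 * cφ * ψc := ⟨_, rfl⟩
  have hcω0 : 0 ≤ cω := by rw [hcω]; positivity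
  set θ : ℝ := 2 * (S * CH * BH * E * (κ * (F.L : ℝ))) with hθ
  have hθ0 : 0 ≤ θ := by positivity
  have hθ16 : 16 * θ ≤ 1 := by
    have e : 16 * θ = 32 * S * CH * BH * E * (κ * (F.L : ℝ)) := by rw [hθ]; ring
    linarith
  set C : ℝ := 2 * Hd * X0 + 1 with hC
  have hC0 : 0 ≤ C := by positivity
  set Q : ℝ := (C₁ + Hd * (12 * cω + 64 * 60800 * ℓ2 * (F.L : ℝ) ^ 2)) * κ ^ 2 with hQ
  have hQ0 : 0 ≤ Q := by positivity
  set B₃ : ℝ := 2 * (F.L : ℝ) ^ 2 + 4 * C with hB₃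
  have hB₃0 : 0 < B₃ := by positivity
  -- the witnesses `a₀`, `a₁`
  obtain ⟨G, hG⟩ : ∃ G : ℝ, G = 2400000 * ℓ2 * (κ * (F.L : ℝ)) + ψc * κ ^ 2 + (16 * Q + 1024 * κ ^ 2) + 32 * κ + κ / τ + 1 / amax := ⟨_, rfl⟩
  have hG0 : 0 ≤ G := by rw [hG]; positivity
  set m₀ : ℝ := min (1 / 1000) (min (deltaSU (Fin N)) (deltaFed (Fin N)) / 2) with hm₀
  set m₁ : ℝ := min (1 / 4) (min (deltaSU (Fin N)) (deltaFed (Fin N)) / 2) with hm₁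
  have hmin0 : 0 < min (deltaSU (Fin N)) (deltaFed (Fin N)) := lt_min hδN hδF
  have hm₀0 : 0 < m₀ := lt_min (by norm_num) (by positivity)
  have hm₁0 : 0 < m₁ := lt_min (by norm_num) (by positivity)
  have hm₀1 : m₀ ≤ 1 / 1000 := min_le_left _ _
  have hm₀N : m₀ < deltaSU (Fin N) := lt_of_le_of_lt (min_le_right _ _) (by linarith [min_le_left (deltaSU (Fin N)) (deltaFed (Fin N))])
  have hm₀F : m₀ < deltaFed (Fin N) := lt_of_le_of_lt (min_le_right _ _) (by linarith [min_le_right (deltaSU (Fin N)) (deltaFed (Fin N))])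
  have hm₁h : m₁ ≤ 1 / 4 := min_le_left _ _
  have hm₁N : m₁ < deltaSU (Fin N) := lt_of_le_of_lt (min_le_right _ _) (by linarith [min_le_left (deltaSU (Fin N)) (deltaFed (Fin N))])
  have hm₁F : m₁ < deltaFed (Fin N) := lt_of_le_of_lt (min_le_right _ _) (by linarith [min_le_right (deltaSU (Fin N)) (deltaFed (Fin N))])
  set a₀ : ℝ := m₀ / (G + 1) with ha₀
  set a₁ : ℝ := m₁ / (X0 + T₁ + TF + 1) with ha₁
  have ha₀0 : 0 < a₀ := by positivity
  have ha₁0 : 0 < a₁ := by positivity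
  -- `t·a₀ ≤ m₀` for every coefficient `t ≤ G`; `a₀ ≤ m₀ ≤ 1`; `(X0 + T₁ + TF)·a₁ ≤ m₁`
  have hGa : ∀ t : ℝ, 0 ≤ t → t ≤ G → t * a₀ ≤ m₀ := by
    intro t ht htG
    rw [ha₀, mul_div_assoc']
    exact div_le_of_le_mul₀ (by positivity) hm₀0.le (by rw [mul_comm]; exact mul_le_mul_of_nonneg_left (by linarith) hm₀0.le)
  have ha₀m : a₀ ≤ m₀ := by
    rw [ha₀]; exact div_le_self hm₀0.le (by linarith)
  have ha₀1 : a₀ ≤ 1 := by linarith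
  have hDa : (X0 + T₁ + TF) * a₁ ≤ m₁ := by
    rw [ha₁, mul_div_assoc']
    exact div_le_of_le_mul₀ (by positivity) hm₁0.le (by rw [mul_comm]; exact mul_le_mul_of_nonneg_left (by linarith) hm₁0.le)
  have hsplit : (X0 + T₁ + TF) * a₁ = X0 * a₁ + T₁ * a₁ + TF * a₁ := by ring
  have hX0a0 : 0 ≤ X0 * a₁ := mul_nonneg hX00 ha₁0.le
  have hT₁a0 : 0 ≤ T₁ * a₁ := mul_nonneg hT₁0 ha₁0.le
  have hTFa0 : 0 ≤ TF * a₁ := mul_nonneg hTF0 ha₁0.le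
  have hX0a : X0 * a₁ ≤ m₁ := by linarith
  have hT₁a : T₁ * a₁ ≤ m₁ := by linarith
  have hTFa : TF * a₁ ≤ m₁ := by linarith
  -- the `a₀`-products, each a summand of `G`
  have hsumm1 : 2400000 * ℓ2 * (κ * (F.L : ℝ)) ≤ G := by
    rw [hG]; linarith [mul_nonneg hψc (sq_nonneg κ), div_nonneg hκ0 hτ.le, (div_pos one_pos hamax).le, sq_nonneg κ]
  have hsumm2 : ψc * κ ^ 2 ≤ G := by
    rw [hG]; linarith [mul_nonneg (mul_nonneg (by norm_num : (0 : ℝ) ≤ 2400000) hℓ20) (mul_nonneg hκ0 hL0), div_nonneg hκ0 hτ.le, (div_pos one_pos hamax).le,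
      sq_nonneg κ]
  have hsumm3 : 16 * Q + 1024 * κ ^ 2 ≤ G := by
    rw [hG]; linarith [mul_nonneg (mul_nonneg (by norm_num : (0 : ℝ) ≤ 2400000) hℓ20) (mul_nonneg hκ0 hL0), mul_nonneg hψc (sq_nonneg κ), div_nonneg hκ0 hτ.le,
      (div_pos one_pos hamax).le]
  have hsumm4 : 32 * κ ≤ G := by
    rw [hG]; linarith [mul_nonneg (mul_nonneg (by norm_num : (0 : ℝ) ≤ 2400000) hℓ20) (mul_nonneg hκ0 hL0), mul_nonneg hψc (sq_nonneg κ), div_nonneg hκ0 hτ.le,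
      (div_pos one_pos hamax).le, sq_nonneg κ]
  have hsumm5 : κ / τ ≤ G := by
    rw [hG]; linarith [mul_nonneg (mul_nonneg (by norm_num : (0 : ℝ) ≤ 2400000) hℓ20) (mul_nonneg hκ0 hL0), mul_nonneg hψc (sq_nonneg κ),
      (div_pos one_pos hamax).le, sq_nonneg κ]
  have hsumm6 : 1 / amax ≤ G := by
    rw [hG]; linarith [mul_nonneg (mul_nonneg (by norm_num : (0 : ℝ) ≤ 2400000) hℓ20) (mul_nonneg hκ0 hL0), mul_nonneg hψc (sq_nonneg κ), div_nonneg hκ0 hτ.le,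
      sq_nonneg κ]
  have hs0 : 0 ≤ κ * a₀ * (F.L : ℝ) := by positivity
  have hℓs : 2400000 * ℓ2 * (κ * a₀ * (F.L : ℝ)) ≤ m₀ := by
    have e : 2400000 * ℓ2 * (κ * a₀ * (F.L : ℝ)) = (2400000 * ℓ2 * (κ * (F.L : ℝ))) * a₀ := by ring
    rw [e]; exact hGa _ (by positivity) hsumm1
  have hψa : ψc * κ ^ 2 * a₀ ≤ m₀ := hGa _ (by positivity) hsumm2
  have hQa : (16 * Q + 1024 * κ ^ 2) * a₀ ≤ 1 := (hGa _ (by positivity) hsumm3).trans (by linarith)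
  have h32a : 32 * κ * a₀ ≤ 1 := (hGa _ (by positivity) hsumm4).trans (by linarith)
  have hκτ : κ * a₀ ≤ τ := by
    have h1 : κ / τ * a₀ ≤ 1 := (hGa _ (div_nonneg hκ0 hτ.le) hsumm5).trans (by linarith)
    have e : κ * a₀ = τ * (κ / τ * a₀) := by field_simp
    rw [e]; exact (mul_le_mul_of_nonneg_left h1 hτ.le).trans (by rw [mul_one])
  have haamax : a₀ ≤ amax := by
    have h1 : 1 / amax * a₀ ≤ 1 := (hGa _ (div_pos one_pos hamax).le hsumm6).trans (by linarith)
    have e : a₀ = amax * (1 / amax * a₀) := by field_simp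
    rw [e]; exact (mul_le_mul_of_nonneg_left h1 hamax.le).trans (by rw [mul_one])
  have hκa₀ : κ * a₀ ≤ 1 := by
    have h0 : 0 ≤ κ * a₀ := by positivity
    linarith
  have hℓs0 : 0 ≤ ℓ2 * (κ * a₀ * (F.L : ℝ)) := by positivity
  -- ★ the per-level letters: for `0 ≤ e ≤ a₀`, `φ ≤ m₀`, `ψ ≤ m₀`, `ω ≤ 8m₀`, `ω ≤ c_ω·(κe)²`
  have hlev : ∀ e : ℝ, 0 ≤ e → e ≤ a₀ →
      0 ≤ ψc * (κ * e) ^ 2 ∧ ψc * (κ * e) ^ 2 ≤ m₀ ∧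
      0 ≤ 100 * (240 * ℓ2 * (κ * e * (F.L : ℝ))) ^ 2 + 6 * (ψc * (κ * e) ^ 2) + 100 * (240 * ℓ2 * (κ * e * (F.L : ℝ))) ^ 2 * (6 * (ψc * (κ * e) ^ 2)) ∧
      100 * (240 * ℓ2 * (κ * e * (F.L : ℝ))) ^ 2 + 6 * (ψc * (κ * e) ^ 2) + 100 * (240 * ℓ2 * (κ * e * (F.L : ℝ))) ^ 2 * (6 * (ψc * (κ * e) ^ 2)) ≤ 8 * m₀ ∧
      100 * (240 * ℓ2 * (κ * e * (F.L : ℝ))) ^ 2 + 6 * (ψc * (κ * e) ^ 2) + 100 * (240 * ℓ2 * (κ * e * (F.L : ℝ))) ^ 2 * (6 * (ψc * (κ * e) ^ 2)) ≤ cω * (κ * e) ^ 2 := by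
    intro e he0 hea
    have hs : κ * e * (F.L : ℝ) ≤ κ * a₀ * (F.L : ℝ) := mul_le_mul_of_nonneg_right (mul_le_mul_of_nonneg_left hea hκ0) hL0
    have hsj0 : 0 ≤ κ * e * (F.L : ℝ) := by positivity
    have hx : 240 * ℓ2 * (κ * e * (F.L : ℝ)) ≤ m₀ / 10000 := by
      have h1 : 240 * ℓ2 * (κ * e * (F.L : ℝ)) ≤ 240 * ℓ2 * (κ * a₀ * (F.L : ℝ)) := mul_le_mul_of_nonneg_left hs (by positivity)
      linarith
    have hx0 : 0 ≤ 240 * ℓ2 * (κ * e * (F.L : ℝ)) := by positivity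
    have hφ : 100 * (240 * ℓ2 * (κ * e * (F.L : ℝ))) ^ 2 ≤ m₀ := by
      have h1 : 240 * ℓ2 * (κ * e * (F.L : ℝ)) ≤ 1 / 100 := by linarith
      have h2 : 240 * ℓ2 * (κ * e * (F.L : ℝ)) * (240 * ℓ2 * (κ * e * (F.L : ℝ))) ≤ 240 * ℓ2 * (κ * e * (F.L : ℝ)) * (1 / 100) :=
        mul_le_mul_of_nonneg_left h1 hx0
      rw [sq]; linarith
    have hφ0 : 0 ≤ 100 * (240 * ℓ2 * (κ * e * (F.L : ℝ))) ^ 2 := by positivity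
    have hκe : (κ * e) ^ 2 ≤ 1 := by
      have h1 : κ * e ≤ κ * a₀ := mul_le_mul_of_nonneg_left hea hκ0
      have h2 : 0 ≤ κ * e := by positivity
      exact pow_le_one₀ h2 (h1.trans hκa₀)
    have hψ : ψc * (κ * e) ^ 2 ≤ m₀ := by
      have h1 : ψc * (κ * e) ^ 2 ≤ ψc * (κ * a₀) ^ 2 :=
        mul_le_mul_of_nonneg_left (pow_le_pow_left₀ (by positivity) (mul_le_mul_of_nonneg_left hea hκ0) 2) hψc
      have h2 : ψc * (κ * a₀) ^ 2 = (ψc * κ ^ 2 * a₀) * a₀ := by ring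
      have h3 : (ψc * κ ^ 2 * a₀) * a₀ ≤ m₀ * 1 := mul_le_mul hψa ha₀1 ha₀0.le hm₀0.le
      linarith
    have hψ0 : 0 ≤ ψc * (κ * e) ^ 2 := by positivity
    have hω : 100 * (240 * ℓ2 * (κ * e * (F.L : ℝ))) ^ 2 + 6 * (ψc * (κ * e) ^ 2) + 100 * (240 * ℓ2 * (κ * e * (F.L : ℝ))) ^ 2 * (6 * (ψc * (κ * e) ^ 2)) ≤ 8 * m₀ := by
      have h1 : 100 * (240 * ℓ2 * (κ * e * (F.L : ℝ))) ^ 2 * (6 * (ψc * (κ * e) ^ 2)) ≤ m₀ * (6 * m₀) :=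
        mul_le_mul hφ (by linarith) (by positivity) hm₀0.le
      have h2 : m₀ * (6 * m₀) ≤ m₀ * 1 := mul_le_mul_of_nonneg_left (by linarith) hm₀0.le
      linarith
    -- `φ = c_φ·(κe)²`, so `ω ≤ (c_φ + 6ψc + 6c_φψc·(κe)²)·(κe)² ≤ c_ω·(κe)²`
    have hφeq : 100 * (240 * ℓ2 * (κ * e * (F.L : ℝ))) ^ 2 = cφ * (κ * e) ^ 2 := by rw [hcφ]; ring
    have hωc : 100 * (240 * ℓ2 * (κ * e * (F.L : ℝ))) ^ 2 + 6 * (ψc * (κ * e) ^ 2) + 100 * (240 * ℓ2 * (κ * e * (F.L : ℝ))) ^ 2 * (6 * (ψc * (κ * e) ^ 2)) ≤ cω * (κ * e) ^ 2 := by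
      rw [hφeq, hcω]
      have hu0 : 0 ≤ (κ * e) ^ 2 := sq_nonneg _
      have h1 : cφ * (κ * e) ^ 2 * (6 * (ψc * (κ * e) ^ 2)) = (6 * cφ * ψc * (κ * e) ^ 2) * (κ * e) ^ 2 := by ring
      have h2 : (6 * cφ * ψc * (κ * e) ^ 2) * (κ * e) ^ 2 ≤ (6 * cφ * ψc * 1) * (κ * e) ^ 2 :=
        mul_le_mul_of_nonneg_right (mul_le_mul_of_nonneg_left hκe (by positivity)) hu0
      calc cφ * (κ * e) ^ 2 + 6 * (ψc * (κ * e) ^ 2) + cφ * (κ * e) ^ 2 * (6 * (ψc * (κ * e) ^ 2))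
          = cφ * (κ * e) ^ 2 + 6 * (ψc * (κ * e) ^ 2) + (6 * cφ * ψc * (κ * e) ^ 2) * (κ * e) ^ 2 := by ring
        _ ≤ cφ * (κ * e) ^ 2 + 6 * (ψc * (κ * e) ^ 2) + (6 * cφ * ψc * 1) * (κ * e) ^ 2 := by linarith [h2]
        _ = (cφ + 6 * ψc + 6 * cφ * ψc) * (κ * e) ^ 2 := by ring
    exact ⟨hψ0, hψ, by positivity, hω, hωc⟩
  refine ⟨B₃, C, θ, Q, a₀, a₁, hB₃0, hC0, hθ0, hQ0, ha₀0, haamax, ha₁0, by rw [hB₃]; linarith, by rw [hB₃]; linarith [sq_nonneg (F.L : ℝ)], hθ16, hQa, h32a, hκτ,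
    by linarith, by linarith, by linarith, by linarith, by linarith, ?_, ?_, ?_, ?_⟩
  · -- MODULE 68's `δ_N`-guard: `ℓ2/4 · ((X + 1)·a₁) = T₁·a₁ ≤ m₁ < δ_N`
    have h1 : ℓ2 / 4 * ((4 * (((4 - 1 : ℕ) : ℝ) * ((2 * F.L - 1 : ℕ) : ℝ)) + 1) * a₁) = T₁ * a₁ := by rw [hT₁]; ring
    rw [h1]; linarith
  · rw [federbushSU_δ]
    have e : 2 * (kF * ((((4 - 1 : ℕ) : ℝ) * ((F.L - 1 : ℕ) : ℝ)) * a₁)) = TF * a₁ := by rw [hTF]; ring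
    rw [e]; linarith
  · -- the per-level defect guards
    intro ε j hε0 hεa
    obtain ⟨hψ0, hψ, hω0, hω, -⟩ := hlev (ε j) hε0 hεa
    obtain ⟨ω, hωdef⟩ : ∃ ω : ℝ, ω = 100 * (240 * ℓ2 * (κ * ε j * (F.L : ℝ))) ^ 2 + 6 * (ψc * (κ * ε j) ^ 2) + 100 * (240 * ℓ2 * (κ * ε j * (F.L : ℝ))) ^ 2 * (6 * (ψc * (κ * ε j) ^ 2)) := ⟨_, rfl⟩
    rw [← hωdef] at hω hω0 ⊢
    have hΩ : ω + ω + ω * ω ≤ 17 * m₀ := by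
      have h1 : ω * ω ≤ (8 * m₀) * (8 * m₀) := mul_le_mul hω hω hω0 (by linarith)
      have h2 : m₀ * m₀ ≤ m₀ * (1 / 64) := mul_le_mul_of_nonneg_left (by linarith) hm₀0.le
      linarith
    refine ⟨hψ0, by linarith, ?_⟩
    linarith
  · -- ★ THE BUDGET ROW
    intro K ε δ j hδ hδa hBδ hεa
    beta_reduce
    rw [hSK K]
    have hδ0 : 0 ≤ δ j := hδ.le
    have hε0 : 0 ≤ ε j := le_trans (by positivity) hBδ
    obtain ⟨hψ0, -, hω0, hω, hωc⟩ := hlev (ε j) hε0 hεa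
    obtain ⟨ω, hωdef⟩ : ∃ ω : ℝ, ω = 100 * (240 * ℓ2 * (κ * ε j * (F.L : ℝ))) ^ 2 + 6 * (ψc * (κ * ε j) ^ 2) + 100 * (240 * ℓ2 * (κ * ε j * (F.L : ℝ))) ^ 2 * (6 * (ψc * (κ * ε j) ^ 2)) := ⟨_, rfl⟩
    rw [← hωdef] at hω hω0 hωc ⊢
    obtain ⟨u, hu⟩ : ∃ u : ℝ, u = (κ * ε j) ^ 2 := ⟨_, rfl⟩
    rw [← hu] at hωc ⊢
    have hu0 : 0 ≤ u := by rw [hu]; positivity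
    -- `Ω ≤ 3ω ≤ 3c_ω u`, `1 + X0 δ ≤ 2`
    have hω1 : ω ≤ 1 := by linarith
    have hΩ : ω + ω + ω * ω ≤ 3 * (cω * u) := by
      have h1 : ω * ω ≤ ω * 1 := mul_le_mul_of_nonneg_left hω1 hω0
      linarith
    have hΩ0 : 0 ≤ ω + ω + ω * ω := by positivity
    have hXδ : X0 * δ j ≤ 1 := by
      have h1 : X0 * δ j ≤ X0 * a₁ := mul_le_mul_of_nonneg_left hδa hX00
      linarith
    have hXδ0 : 0 ≤ X0 * δ j := mul_nonneg hX00 hδ0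
    have hΩX : (ω + ω + ω * ω) * (1 + X0 * δ j) ≤ 3 * (cω * u) * 2 := mul_le_mul hΩ (by linarith) (by positivity) (by positivity)
    -- the bracket of `β₁`
    have hsq : (κ * ε j * (F.L : ℝ)) ^ 2 = (F.L : ℝ) ^ 2 * u := by rw [hu]; ring
    rw [hsq]
    have hbr : 2 * (X0 * δ j + (ω + ω + ω * ω) * (1 + X0 * δ j)) + 64 * 60800 * ℓ2 * ((F.L : ℝ) ^ 2 * u) ≤
        2 * X0 * δ j + (12 * cω + 64 * 60800 * ℓ2 * (F.L : ℝ) ^ 2) * u := by linarith [hΩX]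
    have hbr0 : 0 ≤ 2 * (X0 * δ j + (ω + ω + ω * ω) * (1 + X0 * δ j)) + 64 * 60800 * ℓ2 * ((F.L : ℝ) ^ 2 * u) := by positivity
    -- the two branches of the `max` are nonnegative; `max ≤ sum`
    have hb1 : 0 ≤ 4 * CH * BH * ((F.L : ℝ) * (2 * (X0 * δ j + (ω + ω + ω * ω) * (1 + X0 * δ j)) + 64 * 60800 * ℓ2 * ((F.L : ℝ) ^ 2 * u))) := by positivity
    have hb2 : 0 ≤ 8 * CH * BH * E * (κ * (F.L : ℝ) * ε j) := by positivity
    have hmax : max (4 * CH * BH * ((F.L : ℝ) * (2 * (X0 * δ j + (ω + ω + ω * ω) * (1 + X0 * δ j)) + 64 * 60800 * ℓ2 * ((F.L : ℝ) ^ 2 * u))))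
        (8 * CH * BH * E * (κ * (F.L : ℝ) * ε j)) ≤
        4 * CH * BH * ((F.L : ℝ) * (2 * (X0 * δ j + (ω + ω + ω * ω) * (1 + X0 * δ j)) + 64 * 60800 * ℓ2 * ((F.L : ℝ) ^ 2 * u))) +
        8 * CH * BH * E * (κ * (F.L : ℝ) * ε j) := max_le (le_add_of_nonneg_right hb2) (le_add_of_nonneg_left hb1)
    -- `¼·S·(branch₁) = Hd·bracket`, `¼·S·(branch₂) = θ·ε`
    have e1 : 1 / 4 * S * (4 * CH * BH * ((F.L : ℝ) * (2 * (X0 * δ j + (ω + ω + ω * ω) * (1 + X0 * δ j)) + 64 * 60800 * ℓ2 * ((F.L : ℝ) ^ 2 * u))) +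
        8 * CH * BH * E * (κ * (F.L : ℝ) * ε j)) =
        Hd * (2 * (X0 * δ j + (ω + ω + ω * ω) * (1 + X0 * δ j)) + 64 * 60800 * ℓ2 * ((F.L : ℝ) ^ 2 * u)) + θ * ε j := by
      rw [hHd, hθ]; ring
    have hHdbr : Hd * (2 * (X0 * δ j + (ω + ω + ω * ω) * (1 + X0 * δ j)) + 64 * 60800 * ℓ2 * ((F.L : ℝ) ^ 2 * u)) ≤
        Hd * (2 * X0 * δ j + (12 * cω + 64 * 60800 * ℓ2 * (F.L : ℝ) ^ 2) * u) := mul_le_mul_of_nonneg_left hbr hHd0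
    have e2 : Hd * (2 * X0 * δ j + (12 * cω + 64 * 60800 * ℓ2 * (F.L : ℝ) ^ 2) * u) = (C - 1) * δ j + (Q - C₁ * κ ^ 2) * ε j ^ 2 := by
      rw [hC, hQ, hu]; ring
    have e3 : C₁ * u = C₁ * κ ^ 2 * ε j ^ 2 := by rw [hu]; ring
    have hquarter : 1 / 4 * S * max (4 * CH * BH * ((F.L : ℝ) * (2 * (X0 * δ j + (ω + ω + ω * ω) * (1 + X0 * δ j)) + 64 * 60800 * ℓ2 * ((F.L : ℝ) ^ 2 * u))))
        (8 * CH * BH * E * (κ * (F.L : ℝ) * ε j)) ≤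
        1 / 4 * S * (4 * CH * BH * ((F.L : ℝ) * (2 * (X0 * δ j + (ω + ω + ω * ω) * (1 + X0 * δ j)) + 64 * 60800 * ℓ2 * ((F.L : ℝ) ^ 2 * u))) +
        8 * CH * BH * E * (κ * (F.L : ℝ) * ε j)) := mul_le_mul_of_nonneg_left hmax (by positivity)
    linarith [hquarter, e1, hHdbr, e2, e3, hδ]

/-! ## §2  The collar letter holds for every large collar (print's «R₁M₁ sufficiently big», [15] (163) p. 304) -/

/-- ★ **THE COLLAR LETTER IS EVENTUALLY TRUE** at the junction's constant `κ := b9OfP F Mc ρ B₁` (affine in `ρ`): for `C_H, B_H, B₁ ≥ 0`, `δ_H > 0` there is `ρth` with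
`32·sideP(Mc, ρ)·C_H·B_H·e^{−δ_H ρ}·(b9OfP F Mc ρ B₁·L) ≤ 1` for every `ρ ≥ ρth` — `sideP ≤ Mc + 44 + 2ρ`, `(ρ+1)² ≤ (8∕δ_H²)·e^{δ_H(ρ+1)∕2}`, then k0-s1's
`exists_collar_threshold` at rate `δ_H∕2`. [cite: Balaban1985Variational, (163) p.304; Balaban1985RegularSpaces, p.98] -/
theorem collar_letter_eventually (Mc : ℕ) {CH BH δH B₁ : ℝ} (hCH : 0 ≤ CH) (hBH : 0 ≤ BH) (hδH : 0 < δH) (hB₁ : 0 ≤ B₁) :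
    ∃ ρth : ℕ, ∀ ρ : ℕ, ρth ≤ ρ →
      32 * ((sideP (F.P 0) Mc ρ : ℕ) : ℝ) * CH * BH * Real.exp (-(δH * (ρ : ℝ))) * (b9OfP F Mc ρ B₁ * (F.L : ℝ)) ≤ 1 := by
  have hL0 : (0 : ℝ) ≤ F.L := Nat.cast_nonneg _
  -- the constant after the polynomial weight is absorbed
  set A₀ : ℝ := 32 * (((Mc : ℝ) + 46) * CH * BH * ((112 * (F.L : ℝ) ^ 5 * B₁ * ((F.L : ℝ) * Mc + 46) + 1) * (F.L : ℝ))) with hA₀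
  have hA₀0 : 0 ≤ A₀ := by positivity
  set A : ℝ := A₀ * (8 / δH ^ 2) * Real.exp (δH / 2) with hA
  have hA0 : 0 ≤ A := by positivity
  obtain ⟨R₁, hR₁⟩ := exists_collar_threshold hA0 one_pos (half_pos hδH)
  refine ⟨R₁, fun ρ hρ => ?_⟩
  have hρ0 : (0 : ℝ) ≤ ρ := Nat.cast_nonneg _
  -- `sideP ≤ (Mc + 46)(ρ + 1)`, `b9OfP ≤ (112L⁵B₁(L·Mc + 46) + 1)(ρ + 1)`
  have hS : ((sideP (F.P 0) Mc ρ : ℕ) : ℝ) ≤ ((Mc : ℝ) + 46) * ((ρ : ℝ) + 1) := by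
    have h1 : ((sideP (F.P 0) Mc ρ : ℕ) : ℝ) ≤ ((Mc + 11 * (F.P 0).d + 2 * ρ : ℕ) : ℝ) := by exact_mod_cast sideP_le (P := F.P 0) Mc ρ
    have h2 : ((Mc + 11 * (F.P 0).d + 2 * ρ : ℕ) : ℝ) = (Mc : ℝ) + 44 + 2 * ρ := by rw [T4Family.P_d]; push_cast; ring
    rw [h2] at h1
    linarith [mul_nonneg (Nat.cast_nonneg Mc : (0 : ℝ) ≤ Mc) hρ0]
  have hS0 : 0 ≤ ((sideP (F.P 0) Mc ρ : ℕ) : ℝ) := Nat.cast_nonneg _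
  have hb9 : b9OfP F Mc ρ B₁ ≤ (112 * (F.L : ℝ) ^ 5 * B₁ * ((F.L : ℝ) * Mc + 46) + 1) * ((ρ : ℝ) + 1) := by
    unfold b9OfP
    push_cast
    have h1 : 0 ≤ 112 * (F.L : ℝ) ^ 5 * B₁ := by positivity
    have h2 : 0 ≤ 112 * (F.L : ℝ) ^ 5 * B₁ * ((F.L : ℝ) * Mc) := mul_nonneg h1 (mul_nonneg hL0 (Nat.cast_nonneg Mc))
    linarith [mul_nonneg h1 hρ0, mul_nonneg h2 hρ0]
  have hb90 : 0 ≤ b9OfP F Mc ρ B₁ := by unfold b9OfP; positivity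
  have hE0 : 0 ≤ Real.exp (-(δH * (ρ : ℝ))) := (Real.exp_pos _).le
  -- the weight
  have hsq : ((ρ : ℝ) + 1) ^ 2 ≤ 8 / δH ^ 2 * Real.exp (δH / 2 * ((ρ : ℝ) + 1)) := by
    have h1 := Real.pow_div_factorial_le_exp (δH / 2 * ((ρ : ℝ) + 1)) (by positivity) 2
    have h2 : (δH / 2 * ((ρ : ℝ) + 1)) ^ 2 / (Nat.factorial 2 : ℕ) = δH ^ 2 / 8 * ((ρ : ℝ) + 1) ^ 2 := by
      rw [Nat.factorial_two]; push_cast; ring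
    rw [h2] at h1
    have hδ2 : 0 < δH ^ 2 := by positivity
    calc ((ρ : ℝ) + 1) ^ 2 = 8 / δH ^ 2 * (δH ^ 2 / 8 * ((ρ : ℝ) + 1) ^ 2) := by field_simp
      _ ≤ 8 / δH ^ 2 * Real.exp (δH / 2 * ((ρ : ℝ) + 1)) := mul_le_mul_of_nonneg_left h1 (by positivity)
  have hexp : Real.exp (δH / 2 * ((ρ : ℝ) + 1)) * Real.exp (-(δH * (ρ : ℝ))) = Real.exp (δH / 2) * Real.exp (-(δH / 2 * (ρ : ℝ))) := by
    rw [← Real.exp_add, ← Real.exp_add]; congr 1; ring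
  -- assemble
  have hmain : 32 * ((sideP (F.P 0) Mc ρ : ℕ) : ℝ) * CH * BH * Real.exp (-(δH * (ρ : ℝ))) * (b9OfP F Mc ρ B₁ * (F.L : ℝ)) ≤
      A₀ * ((ρ : ℝ) + 1) ^ 2 * Real.exp (-(δH * (ρ : ℝ))) := by
    have h1 : ((sideP (F.P 0) Mc ρ : ℕ) : ℝ) * (b9OfP F Mc ρ B₁) ≤ (((Mc : ℝ) + 46) * ((ρ : ℝ) + 1)) * ((112 * (F.L : ℝ) ^ 5 * B₁ * ((F.L : ℝ) * Mc + 46) + 1) * ((ρ : ℝ) + 1)) :=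
      mul_le_mul hS hb9 hb90 (by positivity)
    have e : 32 * ((sideP (F.P 0) Mc ρ : ℕ) : ℝ) * CH * BH * Real.exp (-(δH * (ρ : ℝ))) * (b9OfP F Mc ρ B₁ * (F.L : ℝ)) =
        (((sideP (F.P 0) Mc ρ : ℕ) : ℝ) * b9OfP F Mc ρ B₁) * (32 * CH * BH * (F.L : ℝ) * Real.exp (-(δH * (ρ : ℝ)))) := by ring
    have e' : A₀ * ((ρ : ℝ) + 1) ^ 2 * Real.exp (-(δH * (ρ : ℝ))) =
        ((((Mc : ℝ) + 46) * ((ρ : ℝ) + 1)) * ((112 * (F.L : ℝ) ^ 5 * B₁ * ((F.L : ℝ) * Mc + 46) + 1) * ((ρ : ℝ) + 1))) * (32 * CH * BH * (F.L : ℝ) * Real.exp (-(δH * (ρ : ℝ)))) := by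
      rw [hA₀]; ring
    rw [e, e']
    exact mul_le_mul_of_nonneg_right h1 (by positivity)
  have hstep : A₀ * ((ρ : ℝ) + 1) ^ 2 * Real.exp (-(δH * (ρ : ℝ))) ≤ A * Real.exp (-(δH / 2 * (ρ : ℝ))) := by
    calc A₀ * ((ρ : ℝ) + 1) ^ 2 * Real.exp (-(δH * (ρ : ℝ)))
        ≤ A₀ * (8 / δH ^ 2 * Real.exp (δH / 2 * ((ρ : ℝ) + 1))) * Real.exp (-(δH * (ρ : ℝ))) :=
          mul_le_mul_of_nonneg_right (mul_le_mul_of_nonneg_left hsq hA₀0) hE0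
      _ = A * Real.exp (-(δH / 2 * (ρ : ℝ))) := by
          rw [hA, mul_assoc (A₀ * (8 / δH ^ 2)) (Real.exp (δH / 2)), ← hexp]; ring
  exact hmain.trans (hstep.trans (hR₁ ρ (by exact_mod_cast hρ)))

end Summit.QuantumFields.YangMills.BalabanUVNodes.N07SymBudgetRowClosure

end
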